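import Mathlib
import HarnessLib
import Literature.Analysis.FluidPDE.CaloricRemainderCalculus

/-!
# Route `UnthreadedDoor` / `ThreadingFlux`, crux `PoloidalLiouville` (stmt-NavierStokesRegularity-1222), antidynamo v2 skeleton
# (sha16 `4ebf5683127b`), rung `stub_singleDegreeRung` (BC5), step S4 ingredient: the LOCAL product rule for the Laplacian,
# `Δ(φ e)(x) = φ Δe + 2 De(∇φ) + (Δφ) e` for `φ`, `e` of class `C²` on an open set `U ∋ x`

Support file (seat leafhand-ns-unthreadeddoor-1 g0, cell decomp-ns), `--supports stmt-NavierStokesRegularity-1222 --as helper`; theorems only.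
Step S4 of the independent-rung plan differentiates the single-degree vorticity `G(t, ‖x − x₀‖) • Λ(x − x₀)` (p797377), whose radial factor is NOT
`C²` at the centre; the tree's product rule `Literature.Analysis.FluidPDE.laplacian_smul_field` asks for global `C²`.  This file localises it with a
smooth bump (both factors are cut off; near `x` nothing changes, and the Laplacian, the gradient and the derivative are germ-local).

* `contDiff_bump_mul_of_contDiffOn`, `contDiff_bump_smul_of_contDiffOn` — cutting off a function that is `Cⁿ` on an open set containing the
  bump's support gives a globally `Cⁿ` function.
* ★ `laplacian_smul_field_of_contDiffOn` — the displayed local product rule.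

HONEST LABEL: generic calculus; nothing here bears on `PoloidalLiouville` (1222) or NS regularity. [folklore]
-/

noncomputable section

-- the summit and its single sub-problem share the name (CONVENTIONS §1)
set_option linter.dupNamespace false

open scoped Topology InnerProductSpace RealInnerProductSpace ContDiff Laplacian
open Filter Set Function Metric
open Literature.Analysis.FluidPDE

namespace Summit.NavierStokesRegularity.NavierStokesRegularity.Theorems.PoloidalLiouville.Antidynamo

variable {F' : Type*} [NormedAddCommGroup F'] [NormedSpace ℝ F']

/-- Cutting off with a bump supported inside `U` a function that is `Cⁿ` on the open set `U` gives a globally `Cⁿ` function (scalar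
multiplication version). [folklore] -/
theorem contDiff_bump_smul_of_contDiffOn {n : ℕ∞} {U : Set (EuclideanSpace ℝ (Fin 3))} (hU : IsOpen U)
    {e : EuclideanSpace ℝ (Fin 3) → F'} (he : ContDiffOn ℝ n e U) {c : EuclideanSpace ℝ (Fin 3)} (b : ContDiffBump c)
    (hb : tsupport (b : EuclideanSpace ℝ (Fin 3) → ℝ) ⊆ U) :
    ContDiff ℝ n fun y => (b y) • e y := by
  rw [contDiff_iff_contDiffAt]
  intro z
  by_cases hz : z ∈ U
  · exact (b.contDiff (n := n)).contDiffAt.smul (he.contDiffAt (hU.mem_nhds hz))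
  · have hb0 : (b : EuclideanSpace ℝ (Fin 3) → ℝ) =ᶠ[𝓝 z] 0 :=
      notMem_tsupport_iff_eventuallyEq.1 fun h => hz (hb h)
    have h0 : (fun y => (b y) • e y) =ᶠ[𝓝 z] fun _ => (0 : F') := hb0.mono fun w hw => by
      simp only [hw, Pi.zero_apply, zero_smul]
    exact contDiffAt_const.congr_of_eventuallyEq h0

/-- Cutting off with a bump supported inside `U` a scalar function that is `Cⁿ` on the open set `U` gives a globally `Cⁿ` function. [folklore] -/
theorem contDiff_bump_mul_of_contDiffOn {n : ℕ∞} {U : Set (EuclideanSpace ℝ (Fin 3))} (hU : IsOpen U)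
    {φ : EuclideanSpace ℝ (Fin 3) → ℝ} (hφ : ContDiffOn ℝ n φ U) {c : EuclideanSpace ℝ (Fin 3)} (b : ContDiffBump c)
    (hb : tsupport (b : EuclideanSpace ℝ (Fin 3) → ℝ) ⊆ U) :
    ContDiff ℝ n fun y => b y * φ y :=
  contDiff_bump_smul_of_contDiffOn (F' := ℝ) hU hφ b hb

/-- ★ LOCAL PRODUCT RULE FOR THE LAPLACIAN: for `φ : ℝ³ → ℝ` and `e : ℝ³ → F'` of class `C²` on an open set `U` and `x ∈ U`,
`Δ(φ e)(x) = φ(x) Δe(x) + 2 De(x)[∇φ(x)] + Δφ(x) e(x)` (localisation of the tree's `laplacian_smul_field`). [folklore] -/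
theorem laplacian_smul_field_of_contDiffOn {F' : Type*} [NormedAddCommGroup F'] [InnerProductSpace ℝ F']
    {U : Set (EuclideanSpace ℝ (Fin 3))} (hU : IsOpen U)
    {φ : EuclideanSpace ℝ (Fin 3) → ℝ} {e : EuclideanSpace ℝ (Fin 3) → F'} (hφ : ContDiffOn ℝ 2 φ U) (he : ContDiffOn ℝ 2 e U)
    {x : EuclideanSpace ℝ (Fin 3)} (hx : x ∈ U) :
    (Δ (fun y => φ y • e y)) x = φ x • (Δ e) x + (2 : ℝ) • fderiv ℝ e x (gradient φ x) + ((Δ φ) x) • e x := by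
  obtain ⟨r, hr, hball⟩ := Metric.isOpen_iff.1 hU x hx
  let b : ContDiffBump x := ⟨r / 4, r / 2, by positivity, by linarith⟩
  have hsupp : tsupport (b : EuclideanSpace ℝ (Fin 3) → ℝ) ⊆ U := by
    rw [b.tsupport_eq]
    exact (closedBall_subset_ball (by show r / 2 < r; linarith)).trans hball
  set φ' : EuclideanSpace ℝ (Fin 3) → ℝ := fun y => b y * φ y with hφ'
  set e' : EuclideanSpace ℝ (Fin 3) → F' := fun y => (b y) • e y with he'
  have hφ'2 : ContDiff ℝ 2 φ' := contDiff_bump_mul_of_contDiffOn (n := 2) hU hφ b hsupp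
  have he'2 : ContDiff ℝ 2 e' := contDiff_bump_smul_of_contDiffOn (n := 2) hU he b hsupp
  -- near `x` nothing changed
  have hb1 : (b : EuclideanSpace ℝ (Fin 3) → ℝ) =ᶠ[𝓝 x] 1 := b.eventuallyEq_one
  have hφe : φ' =ᶠ[𝓝 x] φ := hb1.mono fun w hw => by simp only [hφ', hw, Pi.one_apply, one_mul]
  have hee : e' =ᶠ[𝓝 x] e := hb1.mono fun w hw => by simp only [he', hw, Pi.one_apply, one_smul]
  have hprod : (fun y => φ' y • e' y) =ᶠ[𝓝 x] fun y => φ y • e y :=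
    (hφe.and hee).mono fun w hw => by
      show φ' w • e' w = φ w • e w
      rw [hw.1, hw.2]
  have hglob := laplacian_smul_field hφ'2 he'2 x
  rw [(InnerProductSpace.laplacian_congr_nhds hprod).eq_of_nhds, (InnerProductSpace.laplacian_congr_nhds hee).eq_of_nhds,
    (InnerProductSpace.laplacian_congr_nhds hφe).eq_of_nhds, hee.fderiv_eq, hφe.gradient_eq, hφe.eq_of_nhds, hee.eq_of_nhds] at hglob
  exact hglob

end Summit.NavierStokesRegularity.NavierStokesRegularity.Theorems.PoloidalLiouville.Antidynamo

end
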